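import Summits.SmoothPoincare4.SmoothPoincare4.Theses.VerlindeRLinks
import Summits.SmoothPoincare4.SmoothPoincare4.Theorems.VrlSlideGap.Negative.SmallComponentCounts
import Literature.Topology.FourManifolds.KirbyMovesProofs
import Literature.Topology.FourManifolds.KirbyCalculusUnlinkProofs
import Literature.Topology.FourManifolds.LinkSurgeryExistence
import Literature.Topology.FourManifolds.KirbyMovesBlowDownProofs
import HarnessLib.Audit

/-!
# `VrlSliceRigidity` — negative-side support: the two R-link hypotheses are load-bearing

Support lemmas for the crux
`Summit.SmoothPoincare4.SmoothPoincare4.Theses.VerlindeRLinks.VrlSliceRigidity`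
(stmt-SmoothPoincare4-16179), from the standing disprover's work file
`Cruxes/VrlSliceRigidity/Disproof.lean` §§1–2 (every variant statement inline, no definition):

  crux:  `∀ [Knot.TubularNbhd.SmoothnessFacts] n L Y …, (H₁) IsSphereTwoProdCircleSum n Y →`
         `(H₂) L.IsSurgery (𝓡 3) Y → (H₃) (∀ i, (L.component i).IsSmoothlySlice) →`
         `∃ U, U.IsZeroFramedUnlink ∧ IsStrictHandleSlideEquivalent ⟨n, L⟩ ⟨n, U⟩`.

* `not_crux_without_isSurgery` — deleting (H₂) makes the statement FALSE at `n = 1`: the `1`-framed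
  unknot is smoothly slice, `S² × S¹` (the PROVED surgery on the `0`-framed unknot,
  `exists_isSurgery_zeroFramedUnlink_holds`) is a `#¹(S² × S¹)`, and the `1`-framed unknot is NOT
  strictly handle-slide equivalent to a `0`-framed unlink — at `n = 1` there are no slides and the
  other moves keep the framing (sibling negative lemma
  `VrlSlideGap.Negative.not_equiv_zeroFramedUnlink_of_framing_ne_zero`).
* `not_crux_without_sphereSum` — deleting (H₁) makes it FALSE at `n = 1`: the `1`-framed unknot has
  a closed CONNECTED surgery `Y` (PROVED existence `FramedLink.exists_isSurgery_holds`; connected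
  because blowing the split `+1`-unknot down — PROVED `FramedLink.IsBlowDown.isSurgery_holds` —
  exhibits the same `Y` as a surgery on the empty link, an image of `S³`;
  `connectedSpace_of_isSurgery_single_unknot_one`), and again does not slide to a `0`-framed unlink.
* `without_slice_iff_strictGPRC` — deleting (H₃) gives back the printed Generalised Property R
  conjecture `StrictGeneralizedPropertyRConjecture` VERBATIM (up to the instance binder): open,
  not refutable, and component sliceness is therefore the crux's ONLY softening of printed GPRC
  (its Andrews–Curtis content is recorded in `FalseOfACObstruction.lean` and in the sibling file
  `VrlSlideGap/Negative/BirthLineVersusSliceRigidity.lean`).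

So any proof of the crux must use BOTH that `Y` is surgery on `L` and that `Y ≅ #ⁿ(S² × S¹)`
(on paper: together they force the linking matrix, in particular every framing, to vanish —
GST 2010 Prop. 2.2, the known stub `stub_framingZero` of line `birth`; at `n = 1` the rest is
Gabai's Property R).  No definition and no named fact is introduced; nothing uses `sorry`.

References: [GompfScharlemannThompson2010, §2 (Conj. 1, Prop. 2.2)]; [GabaiJDG1987, Cor. 8.3];
[Kirby1978, Thm 1 move (1)]; [GompfStipsicz1999, §5.1, §5.3].
-/

noncomputable section

-- The namespace is prescribed by the crux protocol (`Summit.<P>.<Sub>.Theorems.<Crux>.Negative`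
-- with `P = Sub = SmoothPoincare4`), hence the duplicated component.
set_option linter.dupNamespace false

namespace Summit.SmoothPoincare4.SmoothPoincare4.Theorems.VrlSliceRigidity.Negative

open scoped Manifold ContDiff Topology
open Set Function Literature.Topology.FourManifolds
open Summit.SmoothPoincare4.SmoothPoincare4.Theses.VerlindeRLinks (VrlSliceRigidity)
open Summit.SmoothPoincare4.SmoothPoincare4.Theorems.VrlSlideGap.Negative
  (not_equiv_zeroFramedUnlink_of_framing_ne_zero)

/-! ## The witness: the `1`-framed unknot -/

/-- The `0`-framed unknot is a `0`-framed unlink: it bounds the standard disc `unknotDisc`, PROVED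
smooth in the tree (`isSmoothDisc_unknotDisc_holds`). [folklore] -/
theorem single_unknot_zero_isZeroFramedUnlink :
    (FramedLink.single unknot 0).IsZeroFramedUnlink :=
  ⟨⟨fun _ ↦ unknotDisc, fun _ ↦ ⟨isSmoothDisc_unknotDisc_holds, fun x ↦ unknotDisc_coe_sphere x⟩,
    fun i j hij ↦ absurd (Subsingleton.elim i j) hij⟩, fun _ ↦ rfl⟩

/-- **The `1`-framed unknot is strictly handle-slide equivalent to no `0`-framed unlink** (framing
rigidity at `n = 1`, sibling lemma `not_equiv_zeroFramedUnlink_of_framing_ne_zero`). [folklore] -/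
theorem not_equiv_single_unknot_one_zeroFramed [Knot.TubularNbhd.SmoothnessFacts]
    {U : FramedLink (Fin 1)} (hU : U.IsZeroFramedUnlink) :
    ¬ IsStrictHandleSlideEquivalent ⟨1, FramedLink.single unknot 1⟩ ⟨1, U⟩ :=
  not_equiv_zeroFramedUnlink_of_framing_ne_zero (by simp) U hU

/-- A surgery on a framed link WITHOUT components is connected: the link complement is all of `S³`
(connected) and its image covers `Y`. [folklore] -/
theorem connectedSpace_of_isSurgery_of_isEmpty {ι : Type*} [Finite ι] [IsEmpty ι]
    (L : FramedLink ι) {Y : Type*} [TopologicalSpace Y] [ChartedSpace (EuclideanSpace ℝ (Fin 3)) Y]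
    (h : L.IsSurgery (𝓡 3) Y) : ConnectedSpace Y := by
  obtain ⟨ν, -, -, jA, jB, hA, -, -, hcov, -, -⟩ := h
  have hsurj : Surjective jA := by
    rw [← Set.range_eq_univ]
    simpa [Set.iUnion_of_empty] using hcov
  haveI : ConnectedSpace (Metric.sphere (0 : EuclideanSpace ℝ (Fin 4)) 1) :=
    connectedSpace_sphere_succ 2
  have hc : IsConnected (L.toLink.complement : Set (Metric.sphere (0 : EuclideanSpace ℝ (Fin 4)) 1)) := by
    have : (L.toLink.complement : Set (Metric.sphere (0 : EuclideanSpace ℝ (Fin 4)) 1)) = univ :=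
      Set.eq_univ_of_forall fun x ↦ (Link.mem_complement_iff _ _).2 fun i ↦ isEmptyElim i
    rw [this]
    exact isConnected_univ
  haveI : ConnectedSpace L.toLink.complement := isConnected_iff_connectedSpace.1 hc
  exact hsurj.connectedSpace hA.isEmbedding.continuous

/-- **Every surgery on the `1`-framed unknot is connected**: blow the split `+1`-framed unknot down
(`FramedLink.IsBlowDown.isSurgery_holds`, PROVED; the blow-down datum is the standard disc, as in
`kirbyMove_blowDown_unknot`) — the same `Y` is then a surgery on the empty link. (On paper
`Y ≅ S³`; connectedness is all that is needed here.) [cite: Kirby1978, Thm 1 move (1)] -/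
theorem connectedSpace_of_isSurgery_single_unknot_one [Knot.TubularNbhd.SmoothnessFacts]
    {Y : Type} [TopologicalSpace Y] [T2Space Y] [SecondCountableTopology Y]
    [ChartedSpace (EuclideanSpace ℝ (Fin 3)) Y] [IsManifold (𝓡 3) ∞ Y]
    (hL : (FramedLink.single unknot 1).IsSurgery (𝓡 3) Y) : ConnectedSpace Y := by
  have hBD : FramedLink.IsBlowDown 1
      ((FramedLink.single unknot (1 : ℤ)).reindex (finSuccEquiv 0).symm) FramedLink.empty :=
    ⟨fun i ↦ i.elim0, rfl, unknotDisc, isSmoothDisc_unknotDisc_holds, unknotDisc_coe_sphere,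
      fun i ↦ i.elim0⟩
  have hL' : ((FramedLink.single unknot (1 : ℤ)).reindex (finSuccEquiv 0).symm).IsSurgery
      (𝓡 3) Y :=
    (FramedLink.isSurgery_reindex_iff_holds _ _).2 hL
  exact connectedSpace_of_isSurgery_of_isEmpty FramedLink.empty
    (FramedLink.IsBlowDown.isSurgery_holds hBD hL')

/-! ## The load-bearing hypotheses -/

/-- **(H₂) `L.IsSurgery (𝓡 3) Y` is load-bearing**: the crux with (H₂) deleted is FALSE — at
`n = 1` take `L` the `1`-framed unknot (slice, `isSmoothlySlice_unknot`) and `Y ≅ S² × S¹`, a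
`#¹(S² × S¹)` (surgery on the `0`-framed unknot, `exists_isSurgery_zeroFramedUnlink_holds`); `L`
slides to no `0`-framed unlink (`not_equiv_single_unknot_one_zeroFramed`). [folklore] -/
theorem not_crux_without_isSurgery [Knot.TubularNbhd.SmoothnessFacts] :
    ¬ ∀ [Knot.TubularNbhd.SmoothnessFacts] (n : ℕ) (L : FramedLink (Fin n)) (Y : Type)
        [TopologicalSpace Y] [T2Space Y] [SecondCountableTopology Y]
        [ChartedSpace (EuclideanSpace ℝ (Fin 3)) Y] [IsManifold (𝓡 3) ∞ Y] [CompactSpace Y]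
        [ConnectedSpace Y],
        IsSphereTwoProdCircleSum n Y → (∀ i : Fin n, (L.component i).IsSmoothlySlice) →
          ∃ U : FramedLink (Fin n), U.IsZeroFramedUnlink ∧
            IsStrictHandleSlideEquivalent ⟨n, L⟩ ⟨n, U⟩ := by
  intro h
  obtain ⟨Y, _, _, _, _, _, _, _, hY, -⟩ :=
    exists_isSurgery_zeroFramedUnlink_holds (FramedLink.single unknot 0)
      single_unknot_zero_isZeroFramedUnlink
  obtain ⟨U, hU, hLU⟩ :=
    @h ‹_› 1 (FramedLink.single unknot 1) Y _ _ _ _ _ _ _ hY (fun _ ↦ isSmoothlySlice_unknot)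
  exact not_equiv_single_unknot_one_zeroFramed hU hLU

/-- **(H₁) `IsSphereTwoProdCircleSum n Y` is load-bearing**: the crux with (H₁) deleted is FALSE —
at `n = 1` the `1`-framed unknot is slice, has a closed connected surgery `Y`
(`FramedLink.exists_isSurgery_holds`, `connectedSpace_of_isSurgery_single_unknot_one`; on paper
`Y = S³`), and slides to no `0`-framed unlink.  Any proof of the crux must use `Y ≅ #ⁿ(S² × S¹)`
(on paper: `H₁(Y) = ℤⁿ` forces the linking matrix of an R-link to vanish, GST 2010 Prop. 2.2).
[cite: GompfScharlemannThompson2010, §2 Prop. 2.2] -/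
theorem not_crux_without_sphereSum [Knot.TubularNbhd.SmoothnessFacts] :
    ¬ ∀ [Knot.TubularNbhd.SmoothnessFacts] (n : ℕ) (L : FramedLink (Fin n)) (Y : Type)
        [TopologicalSpace Y] [T2Space Y] [SecondCountableTopology Y]
        [ChartedSpace (EuclideanSpace ℝ (Fin 3)) Y] [IsManifold (𝓡 3) ∞ Y] [CompactSpace Y]
        [ConnectedSpace Y],
        L.IsSurgery (𝓡 3) Y → (∀ i : Fin n, (L.component i).IsSmoothlySlice) →
          ∃ U : FramedLink (Fin n), U.IsZeroFramedUnlink ∧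
            IsStrictHandleSlideEquivalent ⟨n, L⟩ ⟨n, U⟩ := by
  intro h
  obtain ⟨Y, _, _, _, _, _, _, hL⟩ := FramedLink.exists_isSurgery_holds (FramedLink.single unknot 1)
  haveI : ConnectedSpace Y := connectedSpace_of_isSurgery_single_unknot_one hL
  obtain ⟨U, hU, hLU⟩ :=
    @h ‹_› 1 (FramedLink.single unknot 1) Y _ _ _ _ _ _ _ hL (fun _ ↦ isSmoothlySlice_unknot)
  exact not_equiv_single_unknot_one_zeroFramed hU hLU

/-- **(H₃) deleted is printed GPRC, verbatim**: the crux with the slice hypothesis removed is the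
tree's `StrictGeneralizedPropertyRConjecture` (Gompf–Scharlemann–Thompson 2010 Conj. 1 over strict
slides) under the same instance binder — open, "probably false" (GST §1), not refutable here; so
component sliceness is the crux's only softening of printed GPRC.
[cite: GompfScharlemannThompson2010, §2 Conjecture 1] -/
theorem without_slice_iff_strictGPRC :
    (∀ [Knot.TubularNbhd.SmoothnessFacts] (n : ℕ) (L : FramedLink (Fin n)) (Y : Type)
        [TopologicalSpace Y] [T2Space Y] [SecondCountableTopology Y]
        [ChartedSpace (EuclideanSpace ℝ (Fin 3)) Y] [IsManifold (𝓡 3) ∞ Y] [CompactSpace Y]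
        [ConnectedSpace Y],
        IsSphereTwoProdCircleSum n Y → L.IsSurgery (𝓡 3) Y →
          ∃ U : FramedLink (Fin n), U.IsZeroFramedUnlink ∧
            IsStrictHandleSlideEquivalent ⟨n, L⟩ ⟨n, U⟩) ↔
      ∀ [Knot.TubularNbhd.SmoothnessFacts], StrictGeneralizedPropertyRConjecture :=
  Iff.rfl

end Summit.SmoothPoincare4.SmoothPoincare4.Theorems.VrlSliceRigidity.Negative

end
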